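import Summits.CriticalPhenomena.PercolationContinuityZ3.Theorems.Transplant.SkelConcRootHop
import Summits.CriticalPhenomena.PercolationContinuityZ3.Theorems.Transplant.SkelKitResiduesO
import Summits.CriticalPhenomena.PercolationContinuityZ3.Theorems.Transplant.SkelKitResidues
import Summits.CriticalPhenomena.PercolationContinuityZ3.Theorems.Transplant.SkelTubeSubO
import Summits.CriticalPhenomena.PercolationContinuityZ3.Theorems.Transplant.SkelTubeSub
import Summits.CriticalPhenomena.PercolationContinuityZ3.Theorems.FK.Transplant.KNFreeLawInterfaces
import Summits.CriticalPhenomena.PercolationContinuityZ3.Theorems.Transplant.KNCellsSchemeO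
import Summits.CriticalPhenomena.PercolationContinuityZ3.Theorems.Transplant.KNCellsProcessO
import Summits.CriticalPhenomena.PercolationContinuityZ3.Theorems.Transplant.KNCellsRunO
import Summits.CriticalPhenomena.PercolationContinuityZ3.Theorems.Transplant.KNCellsRunInvO
import Summits.CriticalPhenomena.PercolationContinuityZ3.Theorems.Transplant.KNCells2SchemeO
import Summits.CriticalPhenomena.PercolationContinuityZ3.Theorems.Transplant.KNCells2RunO
import Summits.CriticalPhenomena.PercolationContinuityZ3.Theorems.Transplant.KNCells2RunInvO
import Summits.CriticalPhenomena.PercolationContinuityZ3.Theorems.Transplant.KNCellsCoverO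
import Summits.CriticalPhenomena.PercolationContinuityZ3.Theorems.Transplant.KNCells2CoverO
import Summits.CriticalPhenomena.PercolationContinuityZ3.Theorems.Transplant.KNCellsReachO
import Summits.CriticalPhenomena.PercolationContinuityZ3.Theorems.Transplant.KNCells2ReachO
import Summits.CriticalPhenomena.PercolationContinuityZ3.Theorems.Transplant.KNCellsExitO
import Summits.CriticalPhenomena.PercolationContinuityZ3.Theorems.Transplant.KNCells2ExitO
import Summits.CriticalPhenomena.PercolationContinuityZ3.Theorems.Transplant.KNCellsStepsDefsO
import Summits.CriticalPhenomena.PercolationContinuityZ3.Theorems.Transplant.KNCellsStepsReachO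
import Summits.CriticalPhenomena.PercolationContinuityZ3.Theorems.Transplant.KNCellsStepsPinO
import Summits.CriticalPhenomena.PercolationContinuityZ3.Theorems.Transplant.KNCellsStepsSubboxO
import Summits.CriticalPhenomena.PercolationContinuityZ3.Theorems.Transplant.KNCellsStepsChainO
import Summits.CriticalPhenomena.PercolationContinuityZ3.Theorems.Transplant.KNCellsStepsFailO
import Summits.CriticalPhenomena.PercolationContinuityZ3.Theorems.Transplant.KNCells2StepsO
import Summits.CriticalPhenomena.PercolationContinuityZ3.Theorems.Transplant.KNCells2FailO
import Summits.CriticalPhenomena.PercolationContinuityZ3.Theorems.Transplant.KNCells2FacePrefixO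
import Summits.CriticalPhenomena.PercolationContinuityZ3.Theorems.Transplant.KNCells2ThetaPosChosenO
import Summits.CriticalPhenomena.PercolationContinuityZ3.Theorems.Transplant.KNCells2KitAtRunO
import Summits.CriticalPhenomena.PercolationContinuityZ3.Theorems.Transplant.KNCells2CorridorO
import Summits.CriticalPhenomena.PercolationContinuityZ3.Theorems.Transplant.KNCells2CorridorEdgeO
import Summits.CriticalPhenomena.PercolationContinuityZ3.Theorems.Transplant.KNCells2SepQO
import Summits.CriticalPhenomena.PercolationContinuityZ3.Theorems.Transplant.KNCells2RootChainO
import Summits.CriticalPhenomena.PercolationContinuityZ3.Theorems.Transplant.SkelWinPackagingO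
import Summits.CriticalPhenomena.PercolationContinuityZ3.Theorems.Transplant.SkelRootSeedLaw
import Literature.Probability.Percolation.OrientedHistorySiteRenormalizationRun
import HarnessLib

/-!
# N2 (frames-only node `SamePDropOfSkeletonFrm₁`, OPEN) — ORIENTED MACRO LAYER (WAVE 0 (c1), (R-18) `q ≡ true`): the oriented twin of N1's `SkelRootSeedLaw`

builds on p205010 (kernel theorem, internal audit signed; external expert review pending) — nothing in this file uses p205010; NOTHING is claimed about the
open node `SamePDropOfSkeletonFrm₁` (`SamePDropOfSkeletonNeg₁` is CLOSED in the tree and untouched by this file).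
Status sentence (coordinator 2026-08-20T04:30Z): "θ(p_c) = 0 on ℤ^d, all d ≥ 2 — kernel-verified (Lean 4/Mathlib, standard axioms); internal adversarial
audit SIGNED 2026-08-20 04:29Z; external expert review pending."
Lane `prim-bschramm-*`, seat `prim-bschramm-stmt` (gen 19); helper file (`--supports stmt-CriticalPhenomena-4575 --as helper`); N2-SCOPE §20, (R-18)/(R-19).
PORT RULES (HOME/prim-bschramm-stmt-g19/lean/port_orient.py): the history-site API is replaced by its ORIENTED twin at the fixed quadrant `qNE := fun _ => true`
(`HState.choice ↦ HState.ochoice qNE`, `mstOf ↦ omstOf qNE`, `mst/stN ↦ omst/ostN qNE`, `occFinal ↦ ooccFinal qNE`, `Lawful ↦ OLawful qNE`, onward directions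
`onward ↦ onwardO` = the POSITIVE ones, (N2-e)); every declaration whose text changes thereby — directly or through a changed declaration — is re-declared with the
suffix `O` (same namespace); unchanged declarations of the N1 file are NOT repeated (the N1 module is imported). Docstrings/citations are N1's.
N1 HEADER (kept for the reader):
* §1 `KSchA.W0pin S F U' := restrW U' (pinW (lattW G S.p) F F)`; `finSupp_W0pin`, `W0pin_apply_of_mem`, `W0pin_eq_one_of_mem`, `le_W0pin_of_mem`, `W0pin_ae_open`,
  `W0pin_eq_zero_of_not_mem_edgeSet`, `isSubbox_W0pin_graph`, `Skel.isSubbox_W0pin_win`;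
* §2 `Skel.root_hsrc_of_pinned` (the hop from a pinned, internally connected source; twin of `Skel.root_hsrc_of_wired`);
* §3 `KSchA.real_W0pin_le_rootLaw` (the transfer, via fk-2's `FK.pinW_self_mono_set`: `P_{W0pin F U'}(⋃_{t∈T} root ↔ t) ≤ P_{pinW lattW U₀ U₀}(⋃_{t∈T} root ↔ t inside Q₀ ∪ E_{0,du})` for `F ⊆ U₀`, `U' ⊆ U0root du`);
* §4 **`Skel.RootOblTW`**, **`Skel.rootObl_of_rootOblTW`**, `Skel.rootOblTW_of_rootOblT`.
[cite: KozmaNitzan2024, §4 p. 27 (G₀), p. 28 ((32) at the root, "positively correlated by the FKG inequality"), Lemma 12 (pp. 23–25)] [cite: GrimmettPercolation1999, Thm. 2.1 p. 32]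
-/
noncomputable section

open MeasureTheory ProbabilityTheory
open scoped ENNReal Classical

namespace Summit.CriticalPhenomena.PercolationContinuityZ3.Theorems

namespace Transplant

/-! ## §1 The root law with a sub-collection of cube edges pinned -/

namespace KNCells

open Literature.Probability.Percolation Literature.Probability.LatticeModels SimpleGraph GadgetSystem ProbeHistory HSiteScheme Contour

namespace KSchA

variable {V : Type} [DecidableEq V] {A : Type*} (G : SimpleGraph V) [G.LocallyFinite] (S : KSchA V A)

variable {G S}

end KSchA

end KNCells

namespace Skel

open Literature.Probability.Percolation Literature.Probability.LatticeModels SimpleGraph KNCells KNLevels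
open Literature.Barriers.CriticalPhenomena (graphBall)

variable {V : Type} [DecidableEq V] {G : SimpleGraph V} [G.LocallyFinite]
variable {A : Type*} {S : KSchA V A}

/-! ## §2 The hop from a pinned, internally connected source -/

end Skel

/-! ## §3 The monotone transfer to the fully pinned root law -/

namespace KNCells

namespace KSchA

open Literature.Probability.Percolation Literature.Probability.LatticeModels SimpleGraph GadgetSystem ProbeHistory HSiteScheme Contour

variable {V : Type} [DecidableEq V] [Countable V] {A : Type*} {G : SimpleGraph V} [G.LocallyFinite] {S : KSchA V A}

end KSchA

end KNCells

/-! ## §4 The law-carrying root obligation -/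

namespace Skel

open Literature.Probability.Percolation Literature.Probability.LatticeModels SimpleGraph KNCells KNLevels
open Literature.Barriers.CriticalPhenomena (graphBall)

variable {V : Type} [DecidableEq V] [Countable V] (G : SimpleGraph V) [G.LocallyFinite] {A : Type*}

/-- **The root obligation in window form WITH THE LAW AS DATA** (N1 (R) design of record): for every direction `du` a linked chain of `n + 1` target steps
in a window graph of some centre `c` and depth `Rπ`, common source the root, under SOME weighting `W` whose root-connection probabilities TRANSFER to the
fully pinned root law inside `Q₀ ∪ E_{0,du}` (first clause), kits at accuracy `δr n`, true targets inside the enlarged ones with excess `≤ η ≤ δr n / 2`, the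
source bound `1 - δr n < P_W((s 0).reachB)` and the last true target inside `M_{a₀}(0 + du)` — `RootOblTO` with `S.W0sub G U'` replaced by `W` + the transfer.
[cite: KozmaNitzan2024, §4 p. 27 (G₀), p. 28 ((32) at the root), Lemma 12 (pp. 23–25)] [this work] -/
def RootOblTWO (S : KSchA V A) (Δ' : ℕ) (δr : ℕ → ℝ) : Prop :=
  ∀ du : MDir, ∃ (n : ℕ) (c : V) (Rπ : ℕ) (W : Sym2 V → unitInterval)
    (s : Fin (n + 1) → KNLevels.TStep (winGraph G c Rπ)) (T' : Fin (n + 1) → Finset V) (η : ℝ),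
    (∀ T : Finset V, (prodBernoulli W).real (⋃ t ∈ T, openConn S.Γ.root t) ≤
      (prodBernoulli (pinW (KNLevels.lattW G S.p) ↑(S.U₀ G) ↑(S.U₀ G))).real
        (⋃ t ∈ (↑T : Set V), openConnIn (↑(S.Γ.Q S.Γ.a₀ 0 ∪ S.Γ.Ewv S.Γ.a₀ 0 du) : Set V) S.Γ.root t)) ∧
    (∀ i : Fin (n + 1), (s i).L.o = S.Γ.root) ∧
    (∀ i : Fin n, T' (Fin.castSucc i) ⊆ (s i.succ).L.X 0) ∧ (∀ i : Fin (n + 1), T' i ⊆ (s i).T) ∧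
    (∀ i : Fin (n + 1), (s i).KitsAt W S.p Δ' (δr n)) ∧ η ≤ δr n / 2 ∧
    (∀ i : Fin (n + 1), (prodBernoulli W).real (⋃ t ∈ (s i).T \ T' i, openConn S.Γ.root t) ≤ η) ∧
    1 - δr n < (prodBernoulli W).real (s 0).L.reachB ∧
    T' (Fin.last n) ⊆ S.Γ.M S.Γ.a₀ ((0 : Site 2) + stepVec du)

variable {G}
variable {S : KSchA V A}

omit [Countable V] in
/-- **`RootOblTWO` + the chain property of every length at `(δr n ↦ δc)` ⟹ the root conjunct (32)** (`KSchA.RootObl G S`, stated inline as in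
`rootObl_of_rootOblTO`): run the chain under its own law `W`, then transfer. [cite: KozmaNitzan2024, §4 p. 28 ((32) at the root), Lemma 12 (pp. 23–25)] -/
theorem rootObl_of_rootOblTWO {Δ' : ℕ} {δr : ℕ → ℝ}
    (hchain : ∀ (n : ℕ) (c : V) (Rπ : ℕ) (Wg : Sym2 V → unitInterval) (s : Fin (n + 1) → KNLevels.TStep (winGraph G c Rπ))
      (T' : Fin (n + 1) → Finset V) (η : ℝ),
      (∀ i : Fin (n + 1), (s i).L.o = (s 0).L.o) →
      (∀ i : Fin n, T' (Fin.castSucc i) ⊆ (s i.succ).L.X 0) →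
      (∀ i : Fin (n + 1), T' i ⊆ (s i).T) →
      (∀ i : Fin (n + 1), (s i).KitsAt Wg S.p Δ' (δr n)) →
      η ≤ δr n / 2 →
      (∀ i : Fin (n + 1), (prodBernoulli Wg).real (⋃ t ∈ (s i).T \ T' i, openConn (s 0).L.o t) ≤ η) →
      1 - δr n < (prodBernoulli Wg).real (s 0).L.reachB →
        1 - S.δc < (prodBernoulli Wg).real (⋃ t ∈ T' (Fin.last n), openConn (s 0).L.o t))
    (hR : RootOblTWO G S Δ' δr) :
    ∀ du : MDir, du.2 = KSchA.qNE du.1 → 1 - S.δc < (prodBernoulli (pinW (KNLevels.lattW G S.p) ↑(S.U₀ G) ↑(S.U₀ G))).real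
      (⋃ t ∈ (↑(S.Γ.M S.Γ.a₀ ((0 : Site 2) + stepVec du)) : Set V),
        openConnIn (↑(S.Γ.Q S.Γ.a₀ 0 ∪ S.Γ.Ewv S.Γ.a₀ 0 du) : Set V) S.Γ.root t) := by
  intro du _hdu
  obtain ⟨n, c, Rπ, W, s, T', η, htr, ho, hlink, hsub, hkits, hη, hexc, hsrc, hTn⟩ := hR du
  have ho' : ∀ i : Fin (n + 1), (s i).L.o = (s 0).L.o := fun i => by rw [ho i, ho 0]
  have hexc' : ∀ i : Fin (n + 1), (prodBernoulli W).real (⋃ t ∈ (s i).T \ T' i, openConn (s 0).L.o t) ≤ η :=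
    fun i => by rw [ho 0]; exact hexc i
  have hc := hchain n c Rπ W s T' η ho' hlink hsub hkits hη hexc' hsrc
  rw [ho 0] at hc
  refine (hc.trans_le (htr (T' (Fin.last n)))).trans_le (measureReal_mono ?_ (measure_ne_top _ _))
  exact biUnion_openConnIn_mono subset_rfl _ (Finset.coe_subset.2 hTn)

/-- **The old window form implies the law-carrying one** (take `W := S.W0sub G U'`; the transfer is the last step of `KSchA.hQ0_of_chain_subO`), so nothing
proved against `RootOblTO` is lost. [folklore] -/
theorem rootOblTW_of_rootOblTO {Δ' : ℕ} {δr : ℕ → ℝ} (hR : RootOblTO G S Δ' δr) : RootOblTWO G S Δ' δr := by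
  intro du
  obtain ⟨n, c, Rπ, U', s, T', η, hU', hroot, ho, hlink, hsub, hkits, hη, hexc, hsrc, hTn⟩ := hR du
  refine ⟨n, c, Rπ, S.W0sub G U', s, T', η, fun T => ?_, ho, hlink, hsub, hkits, hη, hexc, hsrc, hTn⟩
  have e : S.W0sub G U' = S.W0pin G (S.U₀ G) U' := rfl
  rw [e]
  exact KSchA.real_W0pin_le_rootLaw subset_rfl hU' hroot T

end Skel

end Transplant

end Summit.CriticalPhenomena.PercolationContinuityZ3.Theorems

end
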